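import Summits.QuantumFields.BalabanUV.Beta.SecondOrderContactAssembly
import Summits.QuantumFields.BalabanUV.Beta.SecondOrderSplitDecay
import Summits.QuantumFields.BalabanUV.Beta.SpineRecursiveParity

/-!
# `BalabanUV.Beta.SecondOrderRemainderTables` — binder row D1, the W-side (L4) of the reflection binder hR, leaf (W-SPLIT-TAD-REM):
# REMAINDER BI-TABLES IN THE TWO SECOND-ORDER SLOTS OF `W2OfK` — additivity, row parity, localisation, zero tadpole
# (β sub-cell, D1 formalisation swarm seat `b2b-balaban-beta-d1-formalise-leaf-05`, gen 5; sequel of `SpineRecursivePureParity` (HR-W-SPLIT-TAD))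

HONEST FRAMING (cell contract, verbatim): «discharging `BetaPertH` makes Bałaban's UV stability UNCONDITIONAL — a real
constructive-QFT result; it is NOT the continuum limit and NOT the Clay problem.»  HONEST DEPENDENCY (verbatim): «continuum YM on T⁴ ⇐
BetaPertH ∧ nine spine estimates (0/9 proved); BetaPertH ⇐ (D1) ∧ (D4) ∧ CAP+tail; G-an2-4 gates asym, D1 and NE2/3/4.»  This module is
[folklore] bookkeeping over tree objects BY NAME; it types no statement of Bałaban's papers, carries no `[cite:]` tag, declares no `def` and no
`Prop` fact, instantiates NO binder of the β-function wall, and is NOT D1, NOT `BetaPertH`, NOT continuum, NOT Clay.  ABSOLUTE RULE (cell,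
verbatim): «No internally-minted statement may enter as a cited fact. Every hypothesis is either kernel-proved in this package or a verbatim
quotation of a PUBLISHED theorem with page reference. The manuscript(s) under audit are NOT citable for their own disputed steps — they are the
thing under adjudication; programme-internal (2001/route/tribunal) claims are never citable.»  Nothing is cited here.

## Why (context only, asserted nowhere below)

The staged W-END (`SpineRooted.axisReflectionCovariant_flipK_TbalOf_JsRecWAtOf`, an2) reads the second-order letter laws (hT2)∕(hM2) with
♯-tables of SIMILARITY SHAPE.  an1-g28's table-level toy (journal l.11301) and the owner's level-`j+1` statement (l.10357) say the actual
letters are of similarity shape UP TO ADDITIVE REMAINDER BI-TABLES — `R₂ κ u κ′ u′` in the `S₂` slot, `Rᴹ κ u ρ w` in the `M₂` slot — whose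
ROWS are parity-odd local kernels.  This file is the slot socket for any such remainders: it asserts no letter law and no shape of the
remainders, only what the END's residual slot `Δ`∕`Rm` requires of their `W2OfK`-contribution — localisation and zero tadpole against `G_j`.

## What is proved (generic `d`, `N`, weight kernel `K`)

* §1 bounds from the table classes (`abs_le_of_locStencil₂`, `abs_le_of_locStencilFM`) and ADDITIVITY IN THE SECOND-ORDER SLOTS for a
  decaying `K` and bounded tables: `vertex2OfK_add_of_bdd`, `mixOfK_add_of_bdd`, **`W2OfK_add_slot₂`**:
  `W2OfK K N S M (S₂ + R₂) (M₂ + Rᴹ) b c = W2OfK K N S M S₂ M₂ b c + (vertex2OfK K N R₂ b c + (mixOfK K N Rᴹ b c + mixOfK K N Rᴹ c b))`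
  (the first-order slots `S`, `M` untouched), and the `W2SymOfK` twin **`W2SymOfK_add_slot₂`** (an2's `vertex2OfK_add_of_summable` ∕
  `mixOfK_add_of_summable` with the summabilities of leaf-10's `summable_colH_mul_bdd`∕`summable_colM_mul_bdd`).
* §2 PARITY: row-parity-odd remainders give parity-odd slot kernels for ANY `K` — `trK_vertex2OfK_of_rows`, `trK_mixOfK_of_rows`,
  `parityOdd_slot₂` (an1's `trK_vertexOfK∕vertexOfM_eq_neg_sgnK_of_rows`, twice).
* §3 LOCALISATION from Literature `vertexFamily₂_vertex2OfK` ∕ `vertexFamily₂_mixOfK` (`LocStencil₂ R₂`, `LocStencilFM N Rᴹ`, decaying `K`):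
  `loc_vertex2OfK`, `loc_mixOfK`, `loc_slot₂`.
* §4 ZERO TADPOLE against any spread sgn-symmetric `G` (an1's `tadpole_eq_zero_of_parity`): `tadpole_vertex2OfK_eq_zero`,
  `tadpole_mixOfK_eq_zero`, **`tadpole_slot₂_eq_zero`**, the symmetrised `tadpole_slot₂_sym_eq_zero`; and §5 the WALL INSTANCE against the step
  propagators `G_i := coDressKBmAt (toSite r) Lc (KInvStep Lc i)` with weight kernel `G_j`, in the END's binder order `μ y ν y′`:
  `loc_slot₂_stepProp`, **`tadpole_slot₂_stepProp_eq_zero`**.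
Provenance: b2b-balaban β sub-cell, D1 formalisation swarm leaf-05 gen 5, 2026-08-20 (v1); no existing file touched.
-/

noncomputable section

open Finset
open scoped BigOperators
open Literature.MathematicalPhysics.QuantumFieldTheory
open Literature.MathematicalPhysics.QuantumFieldTheory.Balaban1983to89
open Literature.MathematicalPhysics.QuantumFieldTheory.Balaban1983to89.Beta
open B12Sec2to5 (l1 l1_nonneg)
open ExpKernelCalculus (MKer Decays BiLoc VertexFamily VertexFamily₂ comp tadpole)
open KernelWard (bdd_of_biLoc)
open AffineAveraging (box toSite)
open OneStepResolventKernel (Fib wsum LocStencil decays_mono)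
open OneStepKernelFamily (KInvStep colH vertexOfK)
open BalabanCompositeJets (LocStencil₂)
open SecondOrderResponse (colM vertexOfM dM K2OfK vertex2OfK mixOfK W2OfK W2SymOfK W2OfK_apply LocStencilFM vertexFamily₂_vertex2OfK
  vertexFamily₂_mixOfK)
open Summit.QuantumFields.BalabanUV.Beta.TameKernelCalculus
open Summit.QuantumFields.BalabanUV.Beta.BorderedHessian (sgnK)
open Summit.QuantumFields.BalabanUV.Beta.BubbleParity (spr_of_decays trK_coDressKBmAt_KInvStep)
open Summit.QuantumFields.BalabanUV.Beta.WardLocusSecondOrder (abs_vertexOfK_le abs_vertexOfM_le)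
open Summit.QuantumFields.BalabanUV.Beta.AxialDressingRooted (coDressKBmAt decays_coDressKBmAt_KInvStep)
open Summit.QuantumFields.BalabanUV.Beta.KernelWardRelativeEnd (tadpole_eq_zero_of_parity)
open Summit.QuantumFields.BalabanUV.Beta.KernelWardRemainderParity (parityOdd_add trK_vertexOfK_eq_neg_sgnK_of_rows
  trK_vertexOfM_eq_neg_sgnK_of_rows)
open Summit.QuantumFields.BalabanUV.Beta.SpineRecursiveParity (parityOdd_smul)
open Summit.QuantumFields.BalabanUV.Beta.SecondOrderContactForm (vertex2OfK_add_of_summable mixOfK_add_of_summable)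
open Summit.QuantumFields.BalabanUV.Beta.SecondOrderSplitDecay (summable_colH_mul_bdd summable_colM_mul_bdd)

namespace Summit.QuantumFields.BalabanUV.Beta.SecondOrderRemainderTables

variable {d N : ℕ}

/-! ## §1 Bounds from the table classes; additivity in the second-order slots -/

section Additivity

/-- [folklore] A local bi-stencil family is entrywise bounded by its constant (`δ ≥ 0`). -/
theorem abs_le_of_locStencil₂ {S₂ : Fin (d + 1) → (Fin (d + 1) → ℤ) → Fin (d + 1) → (Fin (d + 1) → ℤ) → MKer (d + 1) (Fib d)} {C δ : ℝ}
    (h : LocStencil₂ S₂ C δ) (hδ : 0 ≤ δ) (κ : Fin (d + 1)) (u : Fin (d + 1) → ℤ) (κ' : Fin (d + 1)) (u' x z : Fin (d + 1) → ℤ)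
    (a b : Fib d) : |S₂ κ u κ' u' x z a b| ≤ C := by
  have h1 : |S₂ κ u κ' u' x z a b| ≤ C * Real.exp (-δ * l1 (u' - u)) := bdd_of_biLoc (h κ u κ' u') hδ x z a b
  have h2 : Real.exp (-δ * l1 (u' - u)) ≤ 1 := Real.exp_le_one_iff.mpr (by nlinarith [l1_nonneg (u' - u)])
  exact h1.trans ((mul_le_mul_of_nonneg_left h2 h.nonneg).trans_eq (mul_one C))

/-- [folklore] A local field–multiplier table is entrywise bounded by its constant (`δ ≥ 0`). -/
theorem abs_le_of_locStencilFM {M₂ : Fin (d + 1) → (Fin (d + 1) → ℤ) → Fin (d + 1) → (Fin (d + 1) → ℤ) → MKer (d + 1) (Fib d)} {C δ : ℝ}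
    (h : LocStencilFM N M₂ C δ) (hδ : 0 ≤ δ) (κ : Fin (d + 1)) (u : Fin (d + 1) → ℤ) (ρ : Fin (d + 1)) (w x z : Fin (d + 1) → ℤ)
    (a b : Fib d) : |M₂ κ u ρ w x z a b| ≤ C := by
  have h1 : |M₂ κ u ρ w x z a b| ≤ C * Real.exp (-δ * l1 (u - (N : ℤ) • w)) := bdd_of_biLoc (h κ u ρ w) hδ x z a b
  have h2 : Real.exp (-δ * l1 (u - (N : ℤ) • w)) ≤ 1 := Real.exp_le_one_iff.mpr (by nlinarith [l1_nonneg (u - (N : ℤ) • w)])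
  exact h1.trans ((mul_le_mul_of_nonneg_left h2 h.nonneg).trans_eq (mul_one C))

variable {K : MKer (d + 1) (Fib d)}

/-- [folklore] **ADDITIVITY OF THE BI-VERTEX IN ITS BI-TABLE** for a decaying `K` and entrywise bounded bi-tables. -/
theorem vertex2OfK_add_of_bdd (hK : ∃ δ C : ℝ, 0 < δ ∧ 0 ≤ C ∧ Decays K C δ)
    {P Q : Fin (d + 1) → (Fin (d + 1) → ℤ) → Fin (d + 1) → (Fin (d + 1) → ℤ) → MKer (d + 1) (Fib d)} {BP BQ : ℝ}
    (hP : ∀ κ u κ' u' x z a b, |P κ u κ' u' x z a b| ≤ BP) (hQ : ∀ κ u κ' u' x z a b, |Q κ u κ' u' x z a b| ≤ BQ)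
    (μ : Fin (d + 1)) (y : Fin (d + 1) → ℤ) (ν : Fin (d + 1)) (y' : Fin (d + 1) → ℤ) :
    vertex2OfK K N (fun κ u κ' u' => P κ u κ' u' + Q κ u κ' u') μ y ν y' = vertex2OfK K N P μ y ν y' + vertex2OfK K N Q μ y ν y' :=
  vertex2OfK_add_of_summable K N μ y ν y'
    (fun κ u κ' x z a b => summable_colH_mul_bdd (N := N) hK (fun u' => hP κ u κ' u' x z a b) ν y' κ')
    (fun κ u κ' x z a b => summable_colH_mul_bdd (N := N) hK (fun u' => hQ κ u κ' u' x z a b) ν y' κ')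
    (fun κ x z a b => summable_colH_mul_bdd (N := N) hK
      (fun u => abs_vertexOfK_le (N := N) hK (fun κ' u' x z a b => hP κ u κ' u' x z a b) ν y' x z a b) μ y κ)
    (fun κ x z a b => summable_colH_mul_bdd (N := N) hK
      (fun u => abs_vertexOfK_le (N := N) hK (fun κ' u' x z a b => hQ κ u κ' u' x z a b) ν y' x z a b) μ y κ)

/-- [folklore] **ADDITIVITY OF THE MIXED BI-VERTEX IN ITS MIXED TABLE** for a decaying `K` and entrywise bounded tables. -/
theorem mixOfK_add_of_bdd [NeZero N] (hK : ∃ δ C : ℝ, 0 < δ ∧ 0 ≤ C ∧ Decays K C δ)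
    {P Q : Fin (d + 1) → (Fin (d + 1) → ℤ) → Fin (d + 1) → (Fin (d + 1) → ℤ) → MKer (d + 1) (Fib d)} {BP BQ : ℝ}
    (hP : ∀ κ u ρ w x z a b, |P κ u ρ w x z a b| ≤ BP) (hQ : ∀ κ u ρ w x z a b, |Q κ u ρ w x z a b| ≤ BQ)
    (μ : Fin (d + 1)) (y : Fin (d + 1) → ℤ) (ν : Fin (d + 1)) (y' : Fin (d + 1) → ℤ) :
    mixOfK K N (fun κ u ρ w => P κ u ρ w + Q κ u ρ w) μ y ν y' = mixOfK K N P μ y ν y' + mixOfK K N Q μ y ν y' :=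
  mixOfK_add_of_summable K N μ y ν y'
    (fun κ u ρ x z a b => summable_colM_mul_bdd (N := N) hK (fun w => hP κ u ρ w x z a b) ν y' ρ)
    (fun κ u ρ x z a b => summable_colM_mul_bdd (N := N) hK (fun w => hQ κ u ρ w x z a b) ν y' ρ)
    (fun κ x z a b => summable_colH_mul_bdd (N := N) hK
      (fun u => abs_vertexOfM_le (N := N) hK (fun ρ w x z a b => hP κ u ρ w x z a b) ν y' x z a b) μ y κ)
    (fun κ x z a b => summable_colH_mul_bdd (N := N) hK
      (fun u => abs_vertexOfM_le (N := N) hK (fun ρ w x z a b => hQ κ u ρ w x z a b) ν y' x z a b) μ y κ)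

/-- [folklore] **ADDITIVITY OF `W2OfK` IN ITS TWO SECOND-ORDER SLOTS**: remainder bi-tables `R₂` (field–field) and `Rᴹ` (field–multiplier)
added to the second-order tables contribute ADDITIVELY `vertex2OfK K N R₂ b c + mixOfK K N Rᴹ b c + mixOfK K N Rᴹ c b`; the first-order
slots `S`, `M` (hence `dM`, `K2OfK`) are untouched.  Decaying `K`, all four second-order tables entrywise bounded. -/
theorem W2OfK_add_slot₂ [NeZero N] (hK : ∃ δ C : ℝ, 0 < δ ∧ 0 ≤ C ∧ Decays K C δ)
    (S M : Fin (d + 1) → (Fin (d + 1) → ℤ) → MKer (d + 1) (Fib d))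
    {S₂ R₂ M₂ RM : Fin (d + 1) → (Fin (d + 1) → ℤ) → Fin (d + 1) → (Fin (d + 1) → ℤ) → MKer (d + 1) (Fib d)} {B₂ C₂ BM CM : ℝ}
    (hS₂ : ∀ κ u κ' u' x z a b, |S₂ κ u κ' u' x z a b| ≤ B₂) (hR₂ : ∀ κ u κ' u' x z a b, |R₂ κ u κ' u' x z a b| ≤ C₂)
    (hM₂ : ∀ κ u ρ w x z a b, |M₂ κ u ρ w x z a b| ≤ BM) (hRM : ∀ κ u ρ w x z a b, |RM κ u ρ w x z a b| ≤ CM)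
    (μ : Fin (d + 1)) (y : Fin (d + 1) → ℤ) (ν : Fin (d + 1)) (y' : Fin (d + 1) → ℤ) :
    W2OfK K N S M (fun κ u κ' u' => S₂ κ u κ' u' + R₂ κ u κ' u') (fun κ u ρ w => M₂ κ u ρ w + RM κ u ρ w) μ y ν y' =
      W2OfK K N S M S₂ M₂ μ y ν y' + (vertex2OfK K N R₂ μ y ν y' + (mixOfK K N RM μ y ν y' + mixOfK K N RM ν y' μ y)) := by
  rw [W2OfK_apply, W2OfK_apply, vertex2OfK_add_of_bdd hK hS₂ hR₂ μ y ν y', mixOfK_add_of_bdd hK hM₂ hRM μ y ν y',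
    mixOfK_add_of_bdd hK hM₂ hRM ν y' μ y]
  abel

/-- [folklore] The same for the swap-symmetrised carrier: `W2SymOfK … (S₂ + R₂) (M₂ + Rᴹ) b c = W2SymOfK … S₂ M₂ b c + ½•(slot b c + slot c b)`
with `slot b c := vertex2OfK K N R₂ b c + (mixOfK K N Rᴹ b c + mixOfK K N Rᴹ c b)`. -/
theorem W2SymOfK_add_slot₂ [NeZero N] (hK : ∃ δ C : ℝ, 0 < δ ∧ 0 ≤ C ∧ Decays K C δ)
    (S M : Fin (d + 1) → (Fin (d + 1) → ℤ) → MKer (d + 1) (Fib d))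
    {S₂ R₂ M₂ RM : Fin (d + 1) → (Fin (d + 1) → ℤ) → Fin (d + 1) → (Fin (d + 1) → ℤ) → MKer (d + 1) (Fib d)} {B₂ C₂ BM CM : ℝ}
    (hS₂ : ∀ κ u κ' u' x z a b, |S₂ κ u κ' u' x z a b| ≤ B₂) (hR₂ : ∀ κ u κ' u' x z a b, |R₂ κ u κ' u' x z a b| ≤ C₂)
    (hM₂ : ∀ κ u ρ w x z a b, |M₂ κ u ρ w x z a b| ≤ BM) (hRM : ∀ κ u ρ w x z a b, |RM κ u ρ w x z a b| ≤ CM)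
    (μ : Fin (d + 1)) (y : Fin (d + 1) → ℤ) (ν : Fin (d + 1)) (y' : Fin (d + 1) → ℤ) :
    W2SymOfK K N S M (fun κ u κ' u' => S₂ κ u κ' u' + R₂ κ u κ' u') (fun κ u ρ w => M₂ κ u ρ w + RM κ u ρ w) μ y ν y' =
      W2SymOfK K N S M S₂ M₂ μ y ν y' +
        (1 / 2 : ℝ) • ((vertex2OfK K N R₂ μ y ν y' + (mixOfK K N RM μ y ν y' + mixOfK K N RM ν y' μ y)) +
          (vertex2OfK K N R₂ ν y' μ y + (mixOfK K N RM ν y' μ y + mixOfK K N RM μ y ν y'))) := by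
  unfold SecondOrderResponse.W2SymOfK
  rw [W2OfK_add_slot₂ hK S M hS₂ hR₂ hM₂ hRM μ y ν y', W2OfK_add_slot₂ hK S M hS₂ hR₂ hM₂ hRM ν y' μ y, ← smul_add]
  congr 1
  abel

end Additivity

/-! ## §2 Row parity of the remainders ⇒ parity of the slot kernels, for ANY weight kernel -/

section Parity

variable (K : MKer (d + 1) (Fib d))

/-- [folklore] **A ROW-PARITY-ODD BI-TABLE HAS A PARITY-ODD BI-VERTEX**, for any weight kernel `K` (the column weights are scalars;
an1's `trK_vertexOfK_eq_neg_sgnK_of_rows` twice). -/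
theorem trK_vertex2OfK_of_rows {R₂ : Fin (d + 1) → (Fin (d + 1) → ℤ) → Fin (d + 1) → (Fin (d + 1) → ℤ) → MKer (d + 1) (Fib d)}
    (h : ∀ κ u κ' u', trK (R₂ κ u κ' u') = -sgnK (R₂ κ u κ' u')) (μ : Fin (d + 1)) (y : Fin (d + 1) → ℤ) (ν : Fin (d + 1))
    (y' : Fin (d + 1) → ℤ) : trK (vertex2OfK K N R₂ μ y ν y') = -sgnK (vertex2OfK K N R₂ μ y ν y') :=
  trK_vertexOfK_eq_neg_sgnK_of_rows K (fun κ u => trK_vertexOfK_eq_neg_sgnK_of_rows K (h κ u) ν y') μ y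

/-- [folklore] **A ROW-PARITY-ODD MIXED TABLE HAS A PARITY-ODD MIXED BI-VERTEX**, for any weight kernel `K`
(`trK_vertexOfM_eq_neg_sgnK_of_rows` inside, `trK_vertexOfK_eq_neg_sgnK_of_rows` outside). -/
theorem trK_mixOfK_of_rows {RM : Fin (d + 1) → (Fin (d + 1) → ℤ) → Fin (d + 1) → (Fin (d + 1) → ℤ) → MKer (d + 1) (Fib d)}
    (h : ∀ κ u ρ w, trK (RM κ u ρ w) = -sgnK (RM κ u ρ w)) (μ : Fin (d + 1)) (y : Fin (d + 1) → ℤ) (ν : Fin (d + 1))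
    (y' : Fin (d + 1) → ℤ) : trK (mixOfK K N RM μ y ν y') = -sgnK (mixOfK K N RM μ y ν y') :=
  trK_vertexOfK_eq_neg_sgnK_of_rows K (fun κ u => trK_vertexOfM_eq_neg_sgnK_of_rows K (h κ u) ν y') μ y

/-- [folklore] **THE SLOT CONTRIBUTION OF ROW-PARITY-ODD REMAINDERS IS PARITY-ODD** (any `K`):
`slot b c := vertex2OfK K N R₂ b c + (mixOfK K N Rᴹ b c + mixOfK K N Rᴹ c b)`. -/
theorem parityOdd_slot₂ {R₂ RM : Fin (d + 1) → (Fin (d + 1) → ℤ) → Fin (d + 1) → (Fin (d + 1) → ℤ) → MKer (d + 1) (Fib d)}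
    (h₂ : ∀ κ u κ' u', trK (R₂ κ u κ' u') = -sgnK (R₂ κ u κ' u')) (hM : ∀ κ u ρ w, trK (RM κ u ρ w) = -sgnK (RM κ u ρ w))
    (μ : Fin (d + 1)) (y : Fin (d + 1) → ℤ) (ν : Fin (d + 1)) (y' : Fin (d + 1) → ℤ) :
    trK (vertex2OfK K N R₂ μ y ν y' + (mixOfK K N RM μ y ν y' + mixOfK K N RM ν y' μ y)) =
      -sgnK (vertex2OfK K N R₂ μ y ν y' + (mixOfK K N RM μ y ν y' + mixOfK K N RM ν y' μ y)) :=
  parityOdd_add (trK_vertex2OfK_of_rows (N := N) K h₂ μ y ν y')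
    (parityOdd_add (trK_mixOfK_of_rows (N := N) K hM μ y ν y') (trK_mixOfK_of_rows (N := N) K hM ν y' μ y))

/-- [folklore] The symmetrised slot contribution `½•(slot b c + slot c b)` is parity-odd as well. -/
theorem parityOdd_slot₂_sym {R₂ RM : Fin (d + 1) → (Fin (d + 1) → ℤ) → Fin (d + 1) → (Fin (d + 1) → ℤ) → MKer (d + 1) (Fib d)}
    (h₂ : ∀ κ u κ' u', trK (R₂ κ u κ' u') = -sgnK (R₂ κ u κ' u')) (hM : ∀ κ u ρ w, trK (RM κ u ρ w) = -sgnK (RM κ u ρ w))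
    (μ : Fin (d + 1)) (y : Fin (d + 1) → ℤ) (ν : Fin (d + 1)) (y' : Fin (d + 1) → ℤ) :
    trK ((1 / 2 : ℝ) • ((vertex2OfK K N R₂ μ y ν y' + (mixOfK K N RM μ y ν y' + mixOfK K N RM ν y' μ y)) +
        (vertex2OfK K N R₂ ν y' μ y + (mixOfK K N RM ν y' μ y + mixOfK K N RM μ y ν y')))) =
      -sgnK ((1 / 2 : ℝ) • ((vertex2OfK K N R₂ μ y ν y' + (mixOfK K N RM μ y ν y' + mixOfK K N RM ν y' μ y)) +
        (vertex2OfK K N R₂ ν y' μ y + (mixOfK K N RM ν y' μ y + mixOfK K N RM μ y ν y')))) :=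
  parityOdd_smul _ (parityOdd_add (parityOdd_slot₂ (N := N) K h₂ hM μ y ν y') (parityOdd_slot₂ (N := N) K h₂ hM ν y' μ y))

end Parity

/-! ## §3 Localisation of the slot kernels -/

section Localisation

variable {K : MKer (d + 1) (Fib d)}

/-- [folklore] **THE BI-VERTEX OF A LOCAL BI-STENCIL FAMILY IS LOCALISED** (decaying `K`; Literature `vertexFamily₂_vertex2OfK`, rate `m/8`). -/
theorem loc_vertex2OfK {C m : ℝ} (hK : Decays K C m) (hC : 0 ≤ C) (hm : 0 < m)
    {R₂ : Fin (d + 1) → (Fin (d + 1) → ℤ) → Fin (d + 1) → (Fin (d + 1) → ℤ) → MKer (d + 1) (Fib d)} {C₂ : ℝ} (hR₂ : LocStencil₂ R₂ C₂ m)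
    (μ : Fin (d + 1)) (y : Fin (d + 1) → ℤ) (ν : Fin (d + 1)) (y' : Fin (d + 1) → ℤ) : Loc (vertex2OfK K N R₂ μ y ν y') :=
  ⟨_, _, _, m / 8, by positivity, vertexFamily₂_vertex2OfK (N := N) hK hC hR₂ hm μ y ν y'⟩

/-- [folklore] **THE MIXED BI-VERTEX OF A LOCAL FIELD–MULTIPLIER TABLE IS LOCALISED** (decaying `K`; Literature `vertexFamily₂_mixOfK`). -/
theorem loc_mixOfK [NeZero N] {C m : ℝ} (hK : Decays K C m) (hC : 0 ≤ C) (hm : 0 < m)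
    {RM : Fin (d + 1) → (Fin (d + 1) → ℤ) → Fin (d + 1) → (Fin (d + 1) → ℤ) → MKer (d + 1) (Fib d)} {CM : ℝ} (hRM : LocStencilFM N RM CM m)
    (μ : Fin (d + 1)) (y : Fin (d + 1) → ℤ) (ν : Fin (d + 1)) (y' : Fin (d + 1) → ℤ) : Loc (mixOfK K N RM μ y ν y') :=
  ⟨_, _, _, m / 8, by positivity, vertexFamily₂_mixOfK (N := N) hK hC hRM hm μ y ν y'⟩

/-- [folklore] **THE SLOT CONTRIBUTION OF LOCAL REMAINDERS IS LOCALISED** — the END's (R-loc) for it. -/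
theorem loc_slot₂ [NeZero N] {C m : ℝ} (hK : Decays K C m) (hC : 0 ≤ C) (hm : 0 < m)
    {R₂ RM : Fin (d + 1) → (Fin (d + 1) → ℤ) → Fin (d + 1) → (Fin (d + 1) → ℤ) → MKer (d + 1) (Fib d)} {C₂ CM : ℝ}
    (hR₂ : LocStencil₂ R₂ C₂ m) (hRM : LocStencilFM N RM CM m)
    (μ : Fin (d + 1)) (y : Fin (d + 1) → ℤ) (ν : Fin (d + 1)) (y' : Fin (d + 1) → ℤ) :
    Loc (vertex2OfK K N R₂ μ y ν y' + (mixOfK K N RM μ y ν y' + mixOfK K N RM ν y' μ y)) :=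
  (loc_vertex2OfK hK hC hm hR₂ μ y ν y').add ((loc_mixOfK hK hC hm hRM μ y ν y').add (loc_mixOfK hK hC hm hRM ν y' μ y))

/-- [folklore] The symmetrised slot contribution is localised. -/
theorem loc_slot₂_sym [NeZero N] {C m : ℝ} (hK : Decays K C m) (hC : 0 ≤ C) (hm : 0 < m)
    {R₂ RM : Fin (d + 1) → (Fin (d + 1) → ℤ) → Fin (d + 1) → (Fin (d + 1) → ℤ) → MKer (d + 1) (Fib d)} {C₂ CM : ℝ}
    (hR₂ : LocStencil₂ R₂ C₂ m) (hRM : LocStencilFM N RM CM m)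
    (μ : Fin (d + 1)) (y : Fin (d + 1) → ℤ) (ν : Fin (d + 1)) (y' : Fin (d + 1) → ℤ) :
    Loc ((1 / 2 : ℝ) • ((vertex2OfK K N R₂ μ y ν y' + (mixOfK K N RM μ y ν y' + mixOfK K N RM ν y' μ y)) +
      (vertex2OfK K N R₂ ν y' μ y + (mixOfK K N RM ν y' μ y + mixOfK K N RM μ y ν y')))) :=
  ((loc_slot₂ hK hC hm hR₂ hRM μ y ν y').add (loc_slot₂ hK hC hm hR₂ hRM ν y' μ y)).smul _

end Localisation

/-! ## §4 Zero tadpole against a spread sgn-symmetric propagator -/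

section Tadpole

variable {K G : MKer (d + 1) (Fib d)}

/-- [folklore] **THE BI-VERTEX OF A ROW-PARITY-ODD LOCAL REMAINDER HAS ZERO TADPOLE** against any spread sgn-symmetric `G`. -/
theorem tadpole_vertex2OfK_eq_zero (hG : Spr G) (hGt : trK G = sgnK G) {C m : ℝ} (hK : Decays K C m) (hC : 0 ≤ C) (hm : 0 < m)
    {R₂ : Fin (d + 1) → (Fin (d + 1) → ℤ) → Fin (d + 1) → (Fin (d + 1) → ℤ) → MKer (d + 1) (Fib d)} {C₂ : ℝ} (hR₂ : LocStencil₂ R₂ C₂ m)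
    (h₂ : ∀ κ u κ' u', trK (R₂ κ u κ' u') = -sgnK (R₂ κ u κ' u'))
    (μ : Fin (d + 1)) (y : Fin (d + 1) → ℤ) (ν : Fin (d + 1)) (y' : Fin (d + 1) → ℤ) : tadpole G (vertex2OfK K N R₂ μ y ν y') = 0 :=
  tadpole_eq_zero_of_parity hG hGt (loc_vertex2OfK hK hC hm hR₂ μ y ν y') (trK_vertex2OfK_of_rows (N := N) K h₂ μ y ν y')

/-- [folklore] **THE MIXED BI-VERTEX OF A ROW-PARITY-ODD LOCAL REMAINDER HAS ZERO TADPOLE** against any spread sgn-symmetric `G`. -/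
theorem tadpole_mixOfK_eq_zero [NeZero N] (hG : Spr G) (hGt : trK G = sgnK G) {C m : ℝ} (hK : Decays K C m) (hC : 0 ≤ C) (hm : 0 < m)
    {RM : Fin (d + 1) → (Fin (d + 1) → ℤ) → Fin (d + 1) → (Fin (d + 1) → ℤ) → MKer (d + 1) (Fib d)} {CM : ℝ} (hRM : LocStencilFM N RM CM m)
    (hM : ∀ κ u ρ w, trK (RM κ u ρ w) = -sgnK (RM κ u ρ w))
    (μ : Fin (d + 1)) (y : Fin (d + 1) → ℤ) (ν : Fin (d + 1)) (y' : Fin (d + 1) → ℤ) : tadpole G (mixOfK K N RM μ y ν y') = 0 :=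
  tadpole_eq_zero_of_parity hG hGt (loc_mixOfK hK hC hm hRM μ y ν y') (trK_mixOfK_of_rows (N := N) K hM μ y ν y')

/-- [folklore] **THE SLOT CONTRIBUTION OF ROW-PARITY-ODD LOCAL REMAINDERS HAS ZERO TADPOLE** against any spread sgn-symmetric `G`
(decaying weight kernel `K`) — the END's `hΔ0`∕`hRm0` for it. -/
theorem tadpole_slot₂_eq_zero [NeZero N] (hG : Spr G) (hGt : trK G = sgnK G) {C m : ℝ} (hK : Decays K C m) (hC : 0 ≤ C) (hm : 0 < m)
    {R₂ RM : Fin (d + 1) → (Fin (d + 1) → ℤ) → Fin (d + 1) → (Fin (d + 1) → ℤ) → MKer (d + 1) (Fib d)} {C₂ CM : ℝ}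
    (hR₂ : LocStencil₂ R₂ C₂ m) (h₂ : ∀ κ u κ' u', trK (R₂ κ u κ' u') = -sgnK (R₂ κ u κ' u'))
    (hRM : LocStencilFM N RM CM m) (hM : ∀ κ u ρ w, trK (RM κ u ρ w) = -sgnK (RM κ u ρ w))
    (μ : Fin (d + 1)) (y : Fin (d + 1) → ℤ) (ν : Fin (d + 1)) (y' : Fin (d + 1) → ℤ) :
    tadpole G (vertex2OfK K N R₂ μ y ν y' + (mixOfK K N RM μ y ν y' + mixOfK K N RM ν y' μ y)) = 0 :=
  tadpole_eq_zero_of_parity hG hGt (loc_slot₂ hK hC hm hR₂ hRM μ y ν y') (parityOdd_slot₂ (N := N) K h₂ hM μ y ν y')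

/-- [folklore] The symmetrised slot contribution has zero tadpole against any spread sgn-symmetric `G`. -/
theorem tadpole_slot₂_sym_eq_zero [NeZero N] (hG : Spr G) (hGt : trK G = sgnK G) {C m : ℝ} (hK : Decays K C m) (hC : 0 ≤ C)
    (hm : 0 < m) {R₂ RM : Fin (d + 1) → (Fin (d + 1) → ℤ) → Fin (d + 1) → (Fin (d + 1) → ℤ) → MKer (d + 1) (Fib d)} {C₂ CM : ℝ}
    (hR₂ : LocStencil₂ R₂ C₂ m) (h₂ : ∀ κ u κ' u', trK (R₂ κ u κ' u') = -sgnK (R₂ κ u κ' u'))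
    (hRM : LocStencilFM N RM CM m) (hM : ∀ κ u ρ w, trK (RM κ u ρ w) = -sgnK (RM κ u ρ w))
    (μ : Fin (d + 1)) (y : Fin (d + 1) → ℤ) (ν : Fin (d + 1)) (y' : Fin (d + 1) → ℤ) :
    tadpole G ((1 / 2 : ℝ) • ((vertex2OfK K N R₂ μ y ν y' + (mixOfK K N RM μ y ν y' + mixOfK K N RM ν y' μ y)) +
      (vertex2OfK K N R₂ ν y' μ y + (mixOfK K N RM ν y' μ y + mixOfK K N RM μ y ν y')))) = 0 :=
  tadpole_eq_zero_of_parity hG hGt (loc_slot₂_sym hK hC hm hR₂ hRM μ y ν y') (parityOdd_slot₂_sym (N := N) K h₂ hM μ y ν y')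

end Tadpole

/-! ## §5 The wall instance: step propagators `G_i`, weight kernel `G_j` -/

section Wall

variable {Lc : ℕ} [NeZero Lc]

/-- [folklore] One common rate for the step propagator `G_j` and two remainder table classes given at SOME positive rates. -/
theorem decays_tables_common {r : Fin (d + 1) → ℕ} (hr : r ∈ box (d + 1) Lc) (j : ℕ)
    {R₂ RM : Fin (d + 1) → (Fin (d + 1) → ℤ) → Fin (d + 1) → (Fin (d + 1) → ℤ) → MKer (d + 1) (Fib d)}
    (hR₂ : ∃ C₂ δ₂ : ℝ, 0 < δ₂ ∧ LocStencil₂ R₂ C₂ δ₂) (hRM : ∃ CM δM : ℝ, 0 < δM ∧ LocStencilFM Lc RM CM δM) :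
    ∃ m C C₂ CM : ℝ, 0 < m ∧ 0 ≤ C ∧ Decays (coDressKBmAt (toSite r) Lc (KInvStep (d := d) Lc j)) C m ∧ LocStencil₂ R₂ C₂ m ∧
      LocStencilFM Lc RM CM m := by
  obtain ⟨δG, C, hδG, hC, hG⟩ := decays_coDressKBmAt_KInvStep (d := d) hr j
  obtain ⟨C₂, δ₂, hδ₂, h₂⟩ := hR₂
  obtain ⟨CM, δM, hδM, hM⟩ := hRM
  refine ⟨min δG (min δ₂ δM), C, C₂, CM, lt_min hδG (lt_min hδ₂ hδM), hC, decays_mono hG hC le_rfl (min_le_left _ _),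
    h₂.mono ((min_le_right _ _).trans (min_le_left _ _)), hM.mono ((min_le_right _ _).trans (min_le_right _ _))⟩

/-- [folklore] **(R-loc) AT THE WALL**: the slot contribution over the weight kernel `G_j` of remainders with SOME local rates is localised,
every level `j`, all bonds. -/
theorem loc_slot₂_stepProp {r : Fin (d + 1) → ℕ} (hr : r ∈ box (d + 1) Lc) (j : ℕ)
    {R₂ RM : Fin (d + 1) → (Fin (d + 1) → ℤ) → Fin (d + 1) → (Fin (d + 1) → ℤ) → MKer (d + 1) (Fib d)}
    (hR₂ : ∃ C₂ δ₂ : ℝ, 0 < δ₂ ∧ LocStencil₂ R₂ C₂ δ₂) (hRM : ∃ CM δM : ℝ, 0 < δM ∧ LocStencilFM Lc RM CM δM)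
    (μ : Fin (d + 1)) (y : Fin (d + 1) → ℤ) (ν : Fin (d + 1)) (y' : Fin (d + 1) → ℤ) :
    Loc (vertex2OfK (coDressKBmAt (toSite r) Lc (KInvStep (d := d) Lc j)) Lc R₂ μ y ν y' +
      (mixOfK (coDressKBmAt (toSite r) Lc (KInvStep (d := d) Lc j)) Lc RM μ y ν y' +
        mixOfK (coDressKBmAt (toSite r) Lc (KInvStep (d := d) Lc j)) Lc RM ν y' μ y)) := by
  obtain ⟨m, C, C₂, CM, hm, hC, hG, h₂, hM⟩ := decays_tables_common hr j hR₂ hRM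
  exact loc_slot₂ hG hC hm h₂ hM μ y ν y'

/-- [folklore] **ZERO TADPOLE AT THE WALL**: against every step propagator `G_i`, the slot contribution over the weight kernel `G_j` of
ROW-PARITY-ODD remainder bi-tables with SOME local rates vanishes — every pair of levels `i`, `j`, all bonds `(μ, y)`, `(ν, y′)`.  With `i = j`
this is the END's `hΔ0`∕`hRm0` socket for the remainder part of re-typed second-order letters. -/
theorem tadpole_slot₂_stepProp_eq_zero {r : Fin (d + 1) → ℕ} (hr : r ∈ box (d + 1) Lc) (i j : ℕ)
    {R₂ RM : Fin (d + 1) → (Fin (d + 1) → ℤ) → Fin (d + 1) → (Fin (d + 1) → ℤ) → MKer (d + 1) (Fib d)}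
    (hR₂ : ∃ C₂ δ₂ : ℝ, 0 < δ₂ ∧ LocStencil₂ R₂ C₂ δ₂) (h₂ : ∀ κ u κ' u', trK (R₂ κ u κ' u') = -sgnK (R₂ κ u κ' u'))
    (hRM : ∃ CM δM : ℝ, 0 < δM ∧ LocStencilFM Lc RM CM δM) (hM : ∀ κ u ρ w, trK (RM κ u ρ w) = -sgnK (RM κ u ρ w))
    (μ : Fin (d + 1)) (y : Fin (d + 1) → ℤ) (ν : Fin (d + 1)) (y' : Fin (d + 1) → ℤ) :
    tadpole (coDressKBmAt (toSite r) Lc (KInvStep (d := d) Lc i))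
      (vertex2OfK (coDressKBmAt (toSite r) Lc (KInvStep (d := d) Lc j)) Lc R₂ μ y ν y' +
        (mixOfK (coDressKBmAt (toSite r) Lc (KInvStep (d := d) Lc j)) Lc RM μ y ν y' +
          mixOfK (coDressKBmAt (toSite r) Lc (KInvStep (d := d) Lc j)) Lc RM ν y' μ y)) = 0 := by
  obtain ⟨m, C, C₂, CM, hm, hC, hG, h₂', hM'⟩ := decays_tables_common hr j hR₂ hRM
  exact tadpole_slot₂_eq_zero (spr_of_decays (decays_coDressKBmAt_KInvStep hr i)) (trK_coDressKBmAt_KInvStep hr i) hG hC hm h₂' h₂ hM' hM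
    μ y ν y'

/-- [folklore] The symmetrised form at the wall (for the swap-symmetrised carrier `W2SymOfK`). -/
theorem tadpole_slot₂_sym_stepProp_eq_zero {r : Fin (d + 1) → ℕ} (hr : r ∈ box (d + 1) Lc) (i j : ℕ)
    {R₂ RM : Fin (d + 1) → (Fin (d + 1) → ℤ) → Fin (d + 1) → (Fin (d + 1) → ℤ) → MKer (d + 1) (Fib d)}
    (hR₂ : ∃ C₂ δ₂ : ℝ, 0 < δ₂ ∧ LocStencil₂ R₂ C₂ δ₂) (h₂ : ∀ κ u κ' u', trK (R₂ κ u κ' u') = -sgnK (R₂ κ u κ' u'))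
    (hRM : ∃ CM δM : ℝ, 0 < δM ∧ LocStencilFM Lc RM CM δM) (hM : ∀ κ u ρ w, trK (RM κ u ρ w) = -sgnK (RM κ u ρ w))
    (μ : Fin (d + 1)) (y : Fin (d + 1) → ℤ) (ν : Fin (d + 1)) (y' : Fin (d + 1) → ℤ) :
    tadpole (coDressKBmAt (toSite r) Lc (KInvStep (d := d) Lc i))
      ((1 / 2 : ℝ) •
        ((vertex2OfK (coDressKBmAt (toSite r) Lc (KInvStep (d := d) Lc j)) Lc R₂ μ y ν y' +
            (mixOfK (coDressKBmAt (toSite r) Lc (KInvStep (d := d) Lc j)) Lc RM μ y ν y' +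
              mixOfK (coDressKBmAt (toSite r) Lc (KInvStep (d := d) Lc j)) Lc RM ν y' μ y)) +
          (vertex2OfK (coDressKBmAt (toSite r) Lc (KInvStep (d := d) Lc j)) Lc R₂ ν y' μ y +
            (mixOfK (coDressKBmAt (toSite r) Lc (KInvStep (d := d) Lc j)) Lc RM ν y' μ y +
              mixOfK (coDressKBmAt (toSite r) Lc (KInvStep (d := d) Lc j)) Lc RM μ y ν y')))) = 0 := by
  obtain ⟨m, C, C₂, CM, hm, hC, hG, h₂', hM'⟩ := decays_tables_common hr j hR₂ hRM
  exact tadpole_slot₂_sym_eq_zero (spr_of_decays (decays_coDressKBmAt_KInvStep hr i)) (trK_coDressKBmAt_KInvStep hr i) hG hC hm h₂' h₂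
    hM' hM μ y ν y'

end Wall

end Summit.QuantumFields.BalabanUV.Beta.SecondOrderRemainderTables

end
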